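import Literature.NumberTheory.GaloisRepresentations.PicardFrobeniusDegDet
import Literature.NumberTheory.EllipticCurves.TateModuleCharpolyOfDegree
import HarnessLib

/-!
# Galois representations of Picard curves from a degree function on `ℤ[φ] ⊆ End Pic(C_{f,Ω})`

Topic `Literature/NumberTheory/GaloisRepresentations`; **proof file** (theorems only; no definitions, no named
facts).  Toward `picardCurve_exists_lambdaAdicRep` (Upton 2009).

The door `picardCurve_exists_lambdaAdicRep_of_degdet` (`PicardFrobeniusDegDet`) reduced Upton's theorem to
"`deg = det`" for `1 - φ^r` on `V_ℓ Pic(C_{f,Ω})` (Mumford §19 Thm. 4 / Milne AV Prop. 12.9 applied to the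
Frobenius).  Milne's proof of Prop. 12.9 is now in the tree as pure algebra
(`Literature.NumberTheory.EllipticCurves.TateModule.charpoly_toMatrix_map_eq_of_degreeFunction`,
`…det_one_sub_map_pow_eq_of_degreeFunction`, on top of Lemmas 12.10–12.11 in
`Literature.Algebra.Polynomial.{PadicRootProductNorms, CharpolyOfMultiplicativeDegree}` and the kernel/cokernel
count of `TateModuleKernelIndexProofs`), so the remaining input shrinks to the EXISTENCE OF THE DEGREE FUNCTION
itself — hypothesis `hδ` of `picardCurve_exists_lambdaAdicRep_of_degreeFunction` below: for the `q`-Frobenius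
`φ` acting on `Pic(C_{f,Ω})` (`C_f : y^p = f(x)` over a finite field `k`, `Ω = k̄`) and a prime `ℓ ≠ char k`,

* (`hcard`) `#Pic[ℓ^n] = ℓ^{2gn}` for all `n` (Mumford §6 Appl. 2 / II.§15: `#A[ℓ^n] = ℓ^{2gn}`; Rosen,
  Thm. 11.12), and
* a function `δ : ℤ[X] → ℤ` — in the geometry, `δ(F) = deg F(φ)` on the Jacobian — which is multiplicative,
  polynomial in the coefficients on monic polynomials of each degree (Mumford §19 Thm. 2, from the theorem of
  the cube), with a monic `P`, `P(n) = δ(X - n)` (the characteristic polynomial of `φ`, Mumford §19 /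
  Milne AV §12), such that for monic `F` with `δ(F) ≠ 0` the `ℓ`-power torsion of `ker F(φ)` is finite of
  order `ℓ^{v_ℓ(δ F)}` (`deg = #ker ×` a power of `char k` for isogenies) and
  `δ(X^r - 1) = #{c ∈ Pic : deg c = 0, φ^r c = c}` for `r ≥ 1` (`1 - φ^r` is separable:
  `deg(1 - φ^r) = #ker(1 - φ^r) = #Pic⁰(C_Ω)^{φ^r}`; Mumford §21, Lang AV VII §1).

Given `hδ`, `det(1 - φ^r | V_ℓ) = δ(X^r - 1)` (`RationalTateModule.det_one_sub_pow_eq_of_degreeFunction`,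
`2g` even) `= #Pic⁰(C_Ω)^{φ^r}`, which is `hD` of `picardCurve_exists_lambdaAdicRep_of_degdet`.

## References

* [MumfordAV1970] D. Mumford, *Abelian Varieties* (1970), §19 Thm. 2, Thm. 4; §21.
* [Milne1986AbelianVarieties] J. S. Milne, *Abelian varieties* (Cornell–Silverman 1986), §12 Prop. 12.4,
  Prop. 12.9; §19 Thm. 19.1.
* [Milne1986JacobianVarieties] J. S. Milne, *Jacobian varieties* (ibid.), §11 Thm. 11.1.
* [Lang1983AbelianVarieties] S. Lang, *Abelian Varieties*, VII §1 Thm. 3.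
* [Upton2009] M. Upton, J. Algebra 322 (2009), Thm. 2.1 and §4.
-/

noncomputable section

open Polynomial
open scoped Classical AddSubgroup

namespace Literature.NumberTheory.GaloisRepresentations

open Literature.NumberTheory.EllipticCurves Literature.NumberTheory.DiophantineGeometry
  Literature.NumberTheory.DiophantineGeometry.AlgFunctionField SuperellipticFunctionField

/-- **`picardCurve_exists_lambdaAdicRep` from the existence of the degree function on `ℤ[φ] ⊆ End J(C_f)`.**
Hypothesis `hδ`: for every finite field `k`, algebraically closed algebraic `Ω ⊇ k`, primes `p, ℓ` non-zero in
`k`, `f ∈ k[X]` separable with `p ∤ deg f`, and the `q`-Frobenius `φ` of `Ω/k` acting on `Pic(C_{f,Ω})`: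
`#Pic[ℓ^n] = ℓ^{2gn}` for all `n`, and there is `δ : ℤ[X] → ℤ` multiplicative, polynomial on monic polynomials
of each degree, with a monic `P`, `P(n) = δ(X - n)`, such that (i) for monic `F` with `δ(F) ≠ 0` the `ℓ`-power
torsion of `ker F(φ)` is finite of order `ℓ^{v_ℓ(δ(F))}`, and (ii) `δ(X^r - 1) = #{c : deg c = 0, φ^r c = c}` for
`r ≥ 1` (in the geometry: `δ(F) = deg F(φ)` on the Jacobian; Mumford §19 Thm. 2 and `deg = #ker` for separable
isogenies).  Conclusion: all of `picardCurve_exists_lambdaAdicRep`, through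
`RationalTateModule.det_one_sub_pow_eq_of_degreeFunction` (Milne AV Prop. 12.9, proved in the tree) and
`picardCurve_exists_lambdaAdicRep_of_degdet`.
[cite: MumfordAV1970, §19 Thm. 2, Thm. 4, §21] [cite: Milne1986AbelianVarieties, §12 Prop. 12.9, §19 Thm. 19.1]
[cite: Upton2009, Thm. 2.1] -/
theorem picardCurve_exists_lambdaAdicRep_of_degreeFunction
    (hδ : ∀ (k : Type) [Field k] [Fintype k] (Ω : Type) [Field Ω] [Algebra k Ω] [IsAlgClosed Ω]
      [Algebra.IsAlgebraic k Ω] (p : ℕ) [Fact p.Prime] (ℓ : ℕ) [Fact ℓ.Prime] (f : k[X]),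
      (p : k) ≠ 0 → (ℓ : k) ≠ 0 → f.Separable → ¬ p ∣ f.natDegree →
      ∀ [Fact (Irreducible (superellipticPoly k Ω p f))] (φ : Ω ≃ₐ[k] Ω), (∀ x : Ω, φ x = x ^ Fintype.card k) →
        ∃ g : ℕ, (∀ n, Nat.card ((SuperellipticPic k Ω p f)[(ℓ ^ n : ℕ)]) = ℓ ^ (2 * g * n)) ∧
        ∃ (δ : ℤ[X] → ℤ) (P : ℤ[X]), (∀ F G : ℤ[X], δ (F * G) = δ F * δ G) ∧ P.Monic ∧
          (∀ m : ℤ, P.eval m = δ (X - C m)) ∧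
          (∀ e : ℕ, ∃ H : MvPolynomial (Fin e) ℚ, ∀ c : Fin e → ℤ,
            (δ (X ^ e + ∑ i : Fin e, C (c i) * X ^ (i : ℕ)) : ℚ) = MvPolynomial.eval (fun i => (c i : ℚ)) H) ∧
          (∀ F : ℤ[X], F.Monic → δ F ≠ 0 →
            {a : SuperellipticPic k Ω p f | (∃ n : ℕ, ℓ ^ n • a = 0) ∧
                (aeval (DistribMulAction.toAddMonoidEnd (Ω ≃ₐ[k] Ω) (SuperellipticPic k Ω p f) φ) F :
                  AddMonoid.End (SuperellipticPic k Ω p f)) a = 0}.Finite ∧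
              Nat.card {a : SuperellipticPic k Ω p f | (∃ n : ℕ, ℓ ^ n • a = 0) ∧
                (aeval (DistribMulAction.toAddMonoidEnd (Ω ≃ₐ[k] Ω) (SuperellipticPic k Ω p f) φ) F :
                  AddMonoid.End (SuperellipticPic k Ω p f)) a = 0} = ℓ ^ padicValInt ℓ (δ F)) ∧
          (∀ r : ℕ, 0 < r → δ (X ^ r - 1) =
            Nat.card {c : SuperellipticPic k Ω p f //
              SuperellipticPic.degree k Ω p f c = 0 ∧ (φ ^ r) • c = c})) :
    picardCurve_exists_lambdaAdicRep := by
  refine picardCurve_exists_lambdaAdicRep_of_degdet fun k _ _ Ω _ _ _ _ p _ ℓ _ f hpk hℓk hsep hndvd _ φ hφ => ?_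
  obtain ⟨g, hcard, δ, P, hmul, hP, hPδ, hpoly, hker, hfix⟩ := hδ k Ω p ℓ f hpk hℓk hsep hndvd φ hφ
  have hcard' : ∀ n, Nat.card ((SuperellipticPic k Ω p f)[(ℓ ^ n : ℕ)]) = ℓ ^ ((2 * g) * n) := hcard
  haveI := TateModule.free_of_card_torsionBy_rank hcard'
  haveI := TateModule.finite_of_card_torsionBy_rank hcard'
  refine ⟨RationalTateModule.finite_of_card_torsionBy_rank hcard', fun r hr => ?_⟩
  rw [RationalTateModule.det_one_sub_pow_eq_of_degreeFunction hcard' φ hmul hP hPδ hpoly hker hr, hfix r hr]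
  push_cast
  rw [show 2 * g * (r + 1) = 2 * (g * (r + 1)) by ring, pow_mul, neg_one_sq, one_pow, one_mul]

end Literature.NumberTheory.GaloisRepresentations
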